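import Literature.Barriers.AtomisticToContinuum.OneDimensionalHardCoreRodsFinal
import Mathlib.MeasureTheory.Integral.Prod
import HarnessLib

/-!
# Neumann-contact hard rods on the ring DO condense: the contact law, not the hard core, is the
# one-dimensional obstruction (ninth audit of `OneDimensionalHardCore`, 2026-08-16)

`Literature/Barriers/AtomisticToContinuum` (D-0021 barrier catalogue, conjunct
`BoseEinsteinCondensation`). Companion of `OneDimensionalHardCoreRods.lean` (the rod barrier
`OneDimensionalHardRods`: for bosonic hard rods `v = ⊤·1_{[0,a]}` on the ring — Dirichlet contact,
the form closure of the conjunct's potentials — `c₀(N, N/ρ, a)/N → 0` for `ρa < 1/2`, proved in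
`OneDimensionalHardCoreRodsFinal.lean`).

This file records, as theorems, the POSITIVE one-dimensional test case that isolates the operative
hypothesis of that barrier. Keep the hard-rod configuration domain
`A_N = {x : all cyclic pair distances ≥ a}` on the ring of circumference `L` and replace the Dirichlet
contact condition by the NEUMANN one (Buffet–Pulé's "Neumann hard cores": the Laplacian on `A_N`
with `∂ₙΨ = 0` on the collision set, unitarily equivalent by the excluded-volume map to FREE bosons
on the compressed region [BuffetPule1986, §1 (1)–(7), there on an interval; here on the ring]). Its
bosonic ground state is the normalised indicator `Ψ_N = Z_N^{-1/2} 1_{A_N}` (zero kinetic energy; for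
`L > Na` the unique permutation-symmetric zero-energy state, `A_N` being connected modulo relabelling) — Feynman's / Penrose–Onsager's "constant on the allowed
configurations" trial state [Feynman1953] [PenroseOnsager1956, §6 (32)–(35)], here EXACT — and
`|Ψ_N|²` is the classical Tonks gas [Tonks1936]. For this state the zero-momentum occupation is
bounded below by the free length left for one more rod:

* `neumannRodZeroMomentumOccupation_ge`: `c₀(N) ≥ N (1 − 2(N−1)a/L)` for all `N ≥ 1`, `L > Na`
  (Penrose–Onsager's free-volume estimate as an inequality: `∫₀ᴸ ρ_N(x, y) dy = N Z_N⁻¹ ∫ 1_A(X, x)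
  F(X) dX` with the free length `F(X) = |{y : (X, y) ∈ A_N}| ≥ L − 2(N−1)a`);
* hence along `L = N/ρ` with `ρa < 1/2`: `c₀(N)/N ≥ 1 − 2ρa > 0` for EVERY `N ≥ 1`
  (`neumannRod_condensateFraction_ge`) and the conjunct's `HasGroundStateBEC` shape holds
  (`exists_linear_le_neumannRodZeroMomentumOccupation`) — macroscopic occupation of the constant
  mode, i.e. Bose–Einstein condensation in a translation-invariant one-dimensional system of
  impenetrable bosons at `T = 0`, at every density `ρ < 1/(2a)` (exactly: `c₀(N)/N =
  [((N−2)/N)(L−(N+1)a)^N + (2/N)(L−Na)^N]/(L(L−Na)^{N−1}) → (1−ρa)e^{−ρa/(1−ρa)}`, the Tonks-gas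
  insertion probability [Widom1963], for every `ρa < 1`; ninth-audit computation, checked by Monte
  Carlo, not typed);
* `neumann_vs_dirichlet_rods`: on the SAME configuration domain, at the same density `ρ < 1/(2a)`,
  with the same positivity, permutation symmetry and translation invariance, Neumann rods condense
  (`c₀/N ≥ 1 − 2ρa`) while Dirichlet rods do not (`c₀/N → 0`, `OneDimensionalHardRods_holds`).

Consequence for the reading of the barrier (parent entry `OneDimensionalHardCore`, evasions (ix) and
caveat (m)(4)): neither "`d = 1`" nor "hard core / excluded volume / impenetrability" is the operative
hypothesis of the Girardeau–Lenard obstruction; the Dirichlet contact law (equivalently the Fermi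
pressure and the density rigidity `S(k) ≲ |k|` it produces; the Tonks gas has `S(0⁺) = (1−ρa)² > 0`,
zero pressure and infinite compressibility, the Pitaevskii–Stringari loophole) is. A proposed
dimension-free sufficient condition for BEC can be tested for non-vacuity on `Z_N^{-1/2}1_{A_N}` (BEC
true) and for sharpness on the Nagamiya–Girardeau rod state of `OneDimensionalHardCoreRods.lean`
(BEC false). The Neumann contact condition is NOT a pair potential of the conjunct's class
(`C¹` trial states of finite energy vanish at contact), so nothing in `blocks:` changes.

## References

* [BuffetPule1986] E. Buffet, J. V. Pulé, *Hard bosons in one dimension*, Ann. Inst. H. Poincaré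
  Phys. Théor. 44 (1986) 327–340 (numdam AIHPA_1986__44_3_327_0): §1, eqs. (1)–(7) (Neumann hard
  cores; unitary equivalence with the free gas on `[0, L − a(N−1)]`; "the transformation D_N maps the
  ground state of H_N onto the ground state of a free Hamiltonian", §2.1), §2.1 (8) (one-body density
  matrix), Thm 1, §2.2 Prop. 2 (steric occupation bound). Their no-condensation theorems concern the
  gas in a weak linear potential or with attractive walls (localised free condensates), not the
  homogeneous ring treated here.
* [Feynman1953] R. P. Feynman, Phys. Rev. 91 (1953) 1291: the ground state "constant on
  non-overlapping configurations" of hard-sphere helium.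
* [PenroseOnsager1956] O. Penrose, L. Onsager, Phys. Rev. 104 (1956) 576: §6, eqs. (31)–(35) (Feynman's
  approximation `ψ ≅ Ω_N^{-1/2}F_N`, "`Ω_N/N!` is the configurational partition function for a classical
  system of N noninteracting hard spheres", `n_M/N ≅ N/(Vz)` and "the fraction of condensed particles is
  about 8%"; read at page level in the Physical Review centenary reprint).
* [Tonks1936] L. Tonks, Phys. Rev. 50 (1936) 955: the one-dimensional hard-rod gas,
  `Z_N = L(L − Na)^{N−1}`.
* [Widom1963] B. Widom, J. Chem. Phys. 39 (1963) 2808: insertion probability `Z_{N+1}/(V Z_N)`.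
* [MazzantiEtAl2008] F. Mazzanti et al., Phys. Rev. Lett. 100 (2008) 020401: Eqs. (2)–(3) (the
  Dirichlet rod gas of the contrast theorem).

## Design notes

Four definitions (`tonksIntegral`, `neumannRodState`, `neumannRodDensityMatrix`,
`neumannRodZeroMomentumOccupation` — the Neumann copies of the rod objects, over the SAME
admissible set `rodAdmissible`) and no named fact; everything else is a theorem. The configuration
integral is defined in the tagged form `Z_N = ∫₀ᴸ dx ∫_{[0,L]^{N−1}} 1_A(X, x) dX` (equal to
`|A_N ∩ [0,L]^N|` by Fubini), which is the form in which the normalisation enters the proof.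
-/

noncomputable section

open MeasureTheory Filter Topology Finset Set
open scoped BigOperators Real ENNReal

namespace Literature.Barriers.AtomisticToContinuum.BoseGas

variable {n : ℕ} {L a : ℝ}

/-! ### The objects -/

/-- The **inserted-rod indicator** `1_{A_{n+1}}(X, x)`: `1` if the configuration of the `n`
spectators `X` together with a rod at `x` is admissible (all cyclic pair distances `≥ a`), else `0`.
[cite: Tonks1936, hard-rod gas in one dimension] -/
def admInd (n : ℕ) (L a : ℝ) (x : ℝ) (X : Fin n → ℝ) : ℝ :=
  Set.indicator {Y : Fin (n + 1) → ℝ | rodAdmissible L a Y} 1 (Fin.snoc X x)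

/-- The **configuration integral of the Tonks gas** in tagged form,
`Z_N = ∫₀ᴸ dx ∫_{[0,L]^{N−1}} 1_{A_N}(X, x) dX = |A_N ∩ [0,L]^N|` (`= L(L − Na)^{N−1}` for `L ≥ Na`;
`Z_0 = 1`). [cite: Tonks1936, hard-rod gas in one dimension] -/
def tonksIntegral : ℕ → ℝ → ℝ → ℝ
  | 0, _, _ => 1
  | n + 1, L, a => ∫ x in Set.Icc 0 L, ∫ X in Set.pi Set.univ (fun _ : Fin n => Set.Icc (0 : ℝ) L),
      admInd n L a x X

/-- **The bosonic ground state of `N` Neumann-contact hard rods** of diameter `a` on the ring of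
circumference `L`: the normalised indicator `Ψ_N = Z_N^{-1/2} 1_{A_N}` of the admissible set (zero
kinetic energy inside `A_N`, Neumann condition at contact; the image of the constant ground state of
the free compressed gas under the excluded-volume map) — Feynman's / Penrose–Onsager's trial state,
exact for this Hamiltonian (Buffet–Pulé work on an interval; the ring version is the same
construction with the cyclic distance). [cite: BuffetPule1986, §1 (1)–(7)] [cite: PenroseOnsager1956, §6 (32)–(35)] -/
def neumannRodState (N : ℕ) (L a : ℝ) (x : Fin N → ℝ) : ℝ :=
  (Real.sqrt (tonksIntegral N L a))⁻¹ * Set.indicator {y : Fin N → ℝ | rodAdmissible L a y} 1 x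

/-- The **one-body density matrix** of the Neumann-rod ground state,
`ρ_N(x, y) = N ∫_{[0,L]^{N−1}} Ψ_N(X, x) Ψ_N(X, y) dX` (`0` for `N = 0`).
[cite: BuffetPule1986, §2.1 (8)] -/
def neumannRodDensityMatrix : (N : ℕ) → ℝ → ℝ → ℝ → ℝ → ℝ
  | 0, _, _, _, _ => 0
  | n + 1, L, a, x, y => (n + 1 : ℝ) *
      ∫ X in Set.pi Set.univ (fun _ : Fin n => Set.Icc (0 : ℝ) L),
        neumannRodState (n + 1) L a (Fin.snoc X x) * neumannRodState (n + 1) L a (Fin.snoc X y)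

/-- The **zero-momentum occupation** `c₀(N) = L⁻¹ ∫₀ᴸ∫₀ᴸ ρ_N(x, y) dx dy = ⟨φ₀, γ_N φ₀⟩` of the
Neumann-rod ground state (constant mode `φ₀ = L^{-1/2}`; the occupation number of a level in the
sense of Buffet–Pulé). [cite: BuffetPule1986, §2.1 (occupation number of a normalised level f)] -/
def neumannRodZeroMomentumOccupation (N : ℕ) (L a : ℝ) : ℝ :=
  L⁻¹ * ∫ x in Set.Icc (0 : ℝ) L, ∫ y in Set.Icc (0 : ℝ) L, neumannRodDensityMatrix N L a x y

/-! ### The inserted-rod indicator -/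

/-- `1_A(X, x) ∈ {0, 1}`. [folklore] -/
theorem admInd_eq_zero_or_one (n : ℕ) (L a x : ℝ) (X : Fin n → ℝ) :
    admInd n L a x X = 0 ∨ admInd n L a x X = 1 := by
  unfold admInd
  by_cases h : (Fin.snoc X x : Fin (n + 1) → ℝ) ∈ {Y : Fin (n + 1) → ℝ | rodAdmissible L a Y}
  · right; rw [Set.indicator_of_mem h, Pi.one_apply]
  · left; rw [Set.indicator_of_notMem h]

/-- `1_A(X, x) ≥ 0`. [folklore] -/
theorem admInd_nonneg (n : ℕ) (L a x : ℝ) (X : Fin n → ℝ) : 0 ≤ admInd n L a x X := by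
  rcases admInd_eq_zero_or_one n L a x X with h | h <;> simp [h]

/-- `1_A(X, x) ≤ 1`. [folklore] -/
theorem admInd_le_one (n : ℕ) (L a x : ℝ) (X : Fin n → ℝ) : admInd n L a x X ≤ 1 := by
  rcases admInd_eq_zero_or_one n L a x X with h | h <;> simp [h]

/-- `|1_A| ≤ 1`. [folklore] -/
theorem norm_admInd_le (n : ℕ) (L a x : ℝ) (X : Fin n → ℝ) : ‖admInd n L a x X‖ ≤ 1 := by
  rw [Real.norm_eq_abs, abs_of_nonneg (admInd_nonneg _ _ _ _ _)]; exact admInd_le_one _ _ _ _ _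

/-- `1_A(X, x) = 1` exactly on admissible configurations. [folklore] -/
theorem admInd_eq_one_iff (n : ℕ) (L a x : ℝ) (X : Fin n → ℝ) :
    admInd n L a x X = 1 ↔ rodAdmissible L a (Fin.snoc X x) := by
  unfold admInd
  by_cases h : (Fin.snoc X x : Fin (n + 1) → ℝ) ∈ {Y : Fin (n + 1) → ℝ | rodAdmissible L a Y}
  · rw [Set.indicator_of_mem h, Pi.one_apply]; exact iff_of_true rfl h
  · rw [Set.indicator_of_notMem h]; exact iff_of_false zero_ne_one h

/-- The inserted-rod indicator is jointly measurable in `(x, X)`. [folklore] -/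
theorem measurable_admInd (n : ℕ) (L a : ℝ) :
    Measurable fun p : ℝ × (Fin n → ℝ) => admInd n L a p.1 p.2 := by
  unfold admInd
  have hsnoc : Measurable fun p : ℝ × (Fin n → ℝ) => (Fin.snoc p.2 p.1 : Fin (n + 1) → ℝ) :=
    (Continuous.finSnoc (A := fun _ : Fin (n + 1) => ℝ) continuous_snd continuous_fst).measurable
  exact (measurable_const.indicator (measurableSet_rodAdmissible L a)).comp hsnoc

/-- The configuration integral is non-negative. [folklore] -/
theorem tonksIntegral_nonneg (n : ℕ) (L a : ℝ) : 0 ≤ tonksIntegral (n + 1) L a :=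
  setIntegral_nonneg measurableSet_Icc fun _ _ =>
    setIntegral_nonneg (MeasurableSet.univ_pi fun _ => measurableSet_Icc) fun _ _ => admInd_nonneg _ _ _ _ _

/-- The Neumann state at a tagged configuration: `Ψ(X, x) = Z^{-1/2} 1_A(X, x)`. [folklore] -/
theorem neumannRodState_snoc (n : ℕ) (L a x : ℝ) (X : Fin n → ℝ) :
    neumannRodState (n + 1) L a (Fin.snoc X x) = (Real.sqrt (tonksIntegral (n + 1) L a))⁻¹ * admInd n L a x X :=
  rfl

/-- **The density matrix through the inserted-rod indicators**:
`ρ_{n+1}(x, y) = (n+1) Z⁻¹ ∫ 1_A(X, x) 1_A(X, y) dX`. [cite: BuffetPule1986, §2.1 (8)] -/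
theorem neumannRodDensityMatrix_eq (n : ℕ) (L a x y : ℝ) :
    neumannRodDensityMatrix (n + 1) L a x y = (n + 1 : ℝ) * ((tonksIntegral (n + 1) L a)⁻¹ *
      ∫ X in Set.pi Set.univ (fun _ : Fin n => Set.Icc (0 : ℝ) L), admInd n L a x X * admInd n L a y X) := by
  have hsq : (Real.sqrt (tonksIntegral (n + 1) L a))⁻¹ * (Real.sqrt (tonksIntegral (n + 1) L a))⁻¹ =
      (tonksIntegral (n + 1) L a)⁻¹ := by
    rw [← mul_inv, Real.mul_self_sqrt (tonksIntegral_nonneg n L a)]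
  have hfun : (fun X : Fin n → ℝ => neumannRodState (n + 1) L a (Fin.snoc X x) *
      neumannRodState (n + 1) L a (Fin.snoc X y)) =
      fun X => (tonksIntegral (n + 1) L a)⁻¹ * (admInd n L a x X * admInd n L a y X) := by
    funext X
    rw [neumannRodState_snoc, neumannRodState_snoc, ← hsq]; ring
  show (n + 1 : ℝ) * ∫ X in Set.pi Set.univ (fun _ : Fin n => Set.Icc (0 : ℝ) L),
    neumannRodState (n + 1) L a (Fin.snoc X x) * neumannRodState (n + 1) L a (Fin.snoc X y) = _
  rw [hfun, integral_const_mul]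

/-! ### Admissibility of an inserted rod -/

/-- The cyclic distance is symmetric. [folklore] -/
theorem ringDist_comm (L u v : ℝ) : ringDist L u v = ringDist L v u := by
  unfold ringDist; rw [abs_sub_comm]

/-- Dropping the inserted rod keeps admissibility. [folklore] -/
theorem rodAdmissible_init {X : Fin n → ℝ} {y : ℝ} (h : rodAdmissible L a (Fin.snoc X y)) :
    rodAdmissible L a X := by
  intro i j hij
  have := h (Fin.castSucc i) (Fin.castSucc j) (fun e => hij (Fin.castSucc_injective _ e))
  simpa [Fin.snoc_castSucc] using this

/-- An inserted rod keeps its distance from every spectator. [folklore] -/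
theorem ringDist_of_rodAdmissible_snoc {X : Fin n → ℝ} {y : ℝ} (h : rodAdmissible L a (Fin.snoc X y))
    (j : Fin n) : a ≤ ringDist L y (X j) := by
  have := h (Fin.last n) (Fin.castSucc j) (Fin.castSucc_lt_last j).ne'
  simpa [Fin.snoc_last, Fin.snoc_castSucc] using this

/-- Inserting a rod at cyclic distance `≥ a` from every spectator of an admissible configuration
is admissible. [folklore] -/
theorem rodAdmissible_snoc {X : Fin n → ℝ} (hX : rodAdmissible L a X) {y : ℝ}
    (hy : ∀ j, a ≤ ringDist L y (X j)) : rodAdmissible L a (Fin.snoc X y) := by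
  intro i j hij
  induction i using Fin.lastCases with
  | last =>
    induction j using Fin.lastCases with
    | last => exact absurd rfl hij
    | cast j => simpa [Fin.snoc_last, Fin.snoc_castSucc] using hy j
  | cast i =>
    induction j using Fin.lastCases with
    | last => simpa [Fin.snoc_last, Fin.snoc_castSucc, ringDist_comm L (X i) y] using hy i
    | cast j =>
      have hij' : i ≠ j := fun e => hij (by rw [e])
      simpa [Fin.snoc_castSucc] using hX i j hij'

/-! ### The excluded length of one spectator is at most `2a` -/

/-- **Excluded length**: on the chart `[0, L]`, the set of points at cyclic distance `< a` from a
point `c ∈ [0, L]` has measure at most `2a`. [folklore] -/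
theorem volume_ringDist_lt_le (hL : 0 < L) (ha : 0 ≤ a) {c : ℝ} (hc : c ∈ Set.Icc 0 L) :
    volume (Set.Icc 0 L ∩ {y | ringDist L y c < a}) ≤ ENNReal.ofReal (2 * a) := by
  set lo := max (c - a) 0 with hlo
  set hi := min (c + a) L with hhi
  have hsub : Set.Icc 0 L ∩ {y | ringDist L y c < a} ⊆
      Set.Icc lo hi ∪ (Set.Ico 0 (c - L + a) ∪ Set.Ioc (c + L - a) L) := by
    rintro y ⟨⟨hy0, hyL⟩, hy⟩
    simp only [Set.mem_setOf_eq, ringDist, min_lt_iff] at hy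
    rcases hy with h | h
    · left
      rw [abs_lt] at h
      refine ⟨max_le (by linarith) hy0, le_min (by linarith) hyL⟩
    · right
      have h' : L - a < |y - c| := by linarith
      rcases lt_abs.1 h' with h1 | h1
      · right; exact ⟨by linarith, hyL⟩
      · left; exact ⟨hy0, by linarith⟩
  have hp1 : 0 ≤ hi - lo := by
    have : lo ≤ hi := max_le (le_min (by linarith) (by linarith [hc.2])) (le_min (by linarith [hc.1]) hL.le)
    linarith
  calc volume (Set.Icc 0 L ∩ {y | ringDist L y c < a})
      ≤ volume (Set.Icc lo hi ∪ (Set.Ico 0 (c - L + a) ∪ Set.Ioc (c + L - a) L)) := measure_mono hsub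
    _ ≤ volume (Set.Icc lo hi) + (volume (Set.Ico 0 (c - L + a)) + volume (Set.Ioc (c + L - a) L)) :=
        (measure_union_le _ _).trans (add_le_add le_rfl (measure_union_le _ _))
    _ = ENNReal.ofReal (hi - lo) + (ENNReal.ofReal (c - L + a - 0) + ENNReal.ofReal (L - (c + L - a))) := by
        rw [Real.volume_Icc, Real.volume_Ico, Real.volume_Ioc]
    _ ≤ ENNReal.ofReal (hi - lo) + (ENNReal.ofReal (max (c - L + a) 0) + ENNReal.ofReal (max (a - c) 0)) := by
        gcongr
        · linarith [le_max_left (c - L + a) 0]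
        · linarith [le_max_left (a - c) 0]
    _ = ENNReal.ofReal (hi - lo + (max (c - L + a) 0 + max (a - c) 0)) := by
        rw [← ENNReal.ofReal_add (le_max_right _ _) (le_max_right _ _), ← ENNReal.ofReal_add hp1
          (add_nonneg (le_max_right _ _) (le_max_right _ _))]
    _ ≤ ENNReal.ofReal (2 * a) := by
        refine ENNReal.ofReal_le_ofReal ?_
        rw [hhi, hlo]
        rcases le_total (c + a) L with h1 | h1 <;> rcases le_total (c - a) 0 with h2 | h2
        · rw [min_eq_left h1, max_eq_right h2, max_eq_right (by linarith), max_eq_left (by linarith)]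
          linarith
        · rw [min_eq_left h1, max_eq_left h2, max_eq_right (by linarith), max_eq_right (by linarith)]
          linarith
        · rw [min_eq_right h1, max_eq_right h2, max_eq_left (by linarith), max_eq_left (by linarith)]
          linarith
        · rw [min_eq_right h1, max_eq_left h2, max_eq_left (by linarith), max_eq_right (by linarith)]
          linarith

/-! ### The free length of an admissible configuration -/

/-- **Free length.** If the spectators `X ∈ [0, L]ⁿ` are mutually admissible, the set of positions
at which one more rod can be inserted has length at least `L − 2na`:
`∫₀ᴸ 1_A(X, y) dy ≥ L − 2na` (the chart minus `n` excluded windows of length `≤ 2a`).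
[cite: PenroseOnsager1956, §6 (32)–(35) (free-volume estimate)] -/
theorem freeLength_ge (hL : 0 < L) (ha : 0 ≤ a) {X : Fin n → ℝ} (hXbox : ∀ j, X j ∈ Set.Icc 0 L)
    (hX : rodAdmissible L a X) :
    L - 2 * n * a ≤ ∫ y in Set.Icc 0 L, admInd n L a y X := by
  set S : Set ℝ := {y | rodAdmissible L a (Fin.snoc X y)} with hS
  have hSm : MeasurableSet S := by
    have hsnoc : Measurable fun y : ℝ => (Fin.snoc X y : Fin (n + 1) → ℝ) :=
      (Continuous.finSnoc (A := fun _ : Fin (n + 1) => ℝ) continuous_const continuous_id).measurable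
    exact hsnoc (measurableSet_rodAdmissible L a)
  -- the integral is the measure of `[0, L] ∩ S`
  have hint : ∫ y in Set.Icc 0 L, admInd n L a y X = (volume (Set.Icc 0 L ∩ S)).toReal := by
    have hpt : ∀ y, admInd n L a y X = S.indicator 1 y := by
      intro y
      unfold admInd
      by_cases h : rodAdmissible L a (Fin.snoc X y)
      · rw [Set.indicator_of_mem (show Fin.snoc X y ∈ {Y : Fin (n + 1) → ℝ | rodAdmissible L a Y}
          from h), Set.indicator_of_mem (show y ∈ S from h), Pi.one_apply, Pi.one_apply]
      · rw [Set.indicator_of_notMem (show Fin.snoc X y ∉ {Y : Fin (n + 1) → ℝ | rodAdmissible L a Y}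
          from h), Set.indicator_of_notMem (show y ∉ S from h)]
    simp_rw [hpt]
    rw [setIntegral_indicator hSm]
    simp only [Pi.one_apply]
    rw [setIntegral_const, smul_eq_mul, mul_one]
    rfl
  rw [hint]
  -- covering of the chart by `S` and the excluded windows
  have hcover : Set.Icc (0 : ℝ) L ⊆
      (Set.Icc 0 L ∩ S) ∪ ⋃ j : Fin n, (Set.Icc 0 L ∩ {y | ringDist L y (X j) < a}) := by
    intro y hy
    by_cases h : ∃ j, ringDist L y (X j) < a
    · obtain ⟨j, hj⟩ := h
      exact Or.inr (Set.mem_iUnion.2 ⟨j, hy, hj⟩)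
    · exact Or.inl ⟨hy, rodAdmissible_snoc hX fun j => not_lt.1 fun hj => h ⟨j, hj⟩⟩
  have hmeas : volume (Set.Icc (0 : ℝ) L) ≤
      volume (Set.Icc 0 L ∩ S) + (n : ℝ≥0∞) * ENNReal.ofReal (2 * a) := by
    calc volume (Set.Icc (0 : ℝ) L)
        ≤ volume ((Set.Icc 0 L ∩ S) ∪ ⋃ j : Fin n, (Set.Icc 0 L ∩ {y | ringDist L y (X j) < a})) :=
          measure_mono hcover
      _ ≤ volume (Set.Icc 0 L ∩ S) +
            volume (⋃ j : Fin n, (Set.Icc 0 L ∩ {y | ringDist L y (X j) < a})) := measure_union_le _ _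
      _ ≤ volume (Set.Icc 0 L ∩ S) +
            ∑ j : Fin n, volume (Set.Icc 0 L ∩ {y | ringDist L y (X j) < a}) :=
          add_le_add le_rfl (measure_iUnion_fintype_le _ _)
      _ ≤ volume (Set.Icc 0 L ∩ S) + ∑ _j : Fin n, ENNReal.ofReal (2 * a) :=
          add_le_add le_rfl (Finset.sum_le_sum fun j _ => volume_ringDist_lt_le hL ha (hXbox j))
      _ = volume (Set.Icc 0 L ∩ S) + (n : ℝ≥0∞) * ENNReal.ofReal (2 * a) := by
          rw [Finset.sum_const, Finset.card_univ, Fintype.card_fin, nsmul_eq_mul]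
  have hfin : volume (Set.Icc 0 L ∩ S) ≠ ⊤ :=
    (measure_mono Set.inter_subset_left).trans_lt (by rw [Real.volume_Icc]; exact ENNReal.ofReal_lt_top) |>.ne
  have hfin2 : (n : ℝ≥0∞) * ENNReal.ofReal (2 * a) ≠ ⊤ :=
    ENNReal.mul_ne_top (ENNReal.natCast_ne_top n) ENNReal.ofReal_ne_top
  rw [Real.volume_Icc, sub_zero] at hmeas
  have h2 := (ENNReal.ofReal_le_iff_le_toReal (ENNReal.add_ne_top.2 ⟨hfin, hfin2⟩)).1 hmeas
  rw [ENNReal.toReal_add hfin hfin2, ENNReal.toReal_mul, ENNReal.toReal_natCast,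
    ENNReal.toReal_ofReal (by positivity)] at h2
  linarith

/-! ### The lower bound on the zero-momentum occupation -/

section Bound

variable (n : ℕ) (L a : ℝ)

/-- The spectator box `[0, L]ⁿ` has finite volume. [folklore] -/
theorem volume_box_lt_top : volume (Set.pi Set.univ (fun _ : Fin n => Set.Icc (0 : ℝ) L)) < ⊤ :=
  volume_pi_lt_top (by rw [Real.volume_Icc]; exact ENNReal.ofReal_lt_top)

/-- The free length `X ↦ ∫₀ᴸ 1_A(X, y) dy` is measurable. [folklore] -/
theorem measurable_freeLength :
    Measurable fun X : Fin n → ℝ => ∫ y in Set.Icc 0 L, admInd n L a y X := by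
  have hsm : StronglyMeasurable (Function.uncurry fun (X : Fin n → ℝ) (y : ℝ) => admInd n L a y X) :=
    ((measurable_admInd n L a).comp (measurable_snd.prodMk measurable_fst)).stronglyMeasurable
  exact (hsm.integral_prod_right' (ν := volume.restrict (Set.Icc (0 : ℝ) L))).measurable

/-- The tagged configuration integral `x ↦ ∫ 1_A(X, x) dX` is measurable. [folklore] -/
theorem measurable_admInd_integral :
    Measurable fun x : ℝ => ∫ X in Set.pi Set.univ (fun _ : Fin n => Set.Icc (0 : ℝ) L), admInd n L a x X :=
  ((measurable_admInd n L a).stronglyMeasurable.integral_prod_right'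
    (ν := volume.restrict (Set.pi Set.univ (fun _ : Fin n => Set.Icc (0 : ℝ) L)))).measurable

/-- The density matrix is jointly measurable. [folklore] -/
theorem measurable_neumannRodDensityMatrix_uncurry :
    Measurable (Function.uncurry (neumannRodDensityMatrix (n + 1) L a)) := by
  have hfun : Function.uncurry (neumannRodDensityMatrix (n + 1) L a) = fun p : ℝ × ℝ =>
      (n + 1 : ℝ) * ((tonksIntegral (n + 1) L a)⁻¹ *
        ∫ X in Set.pi Set.univ (fun _ : Fin n => Set.Icc (0 : ℝ) L), admInd n L a p.1 X * admInd n L a p.2 X) := by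
    funext p; exact neumannRodDensityMatrix_eq n L a p.1 p.2
  rw [hfun]
  refine measurable_const.mul (measurable_const.mul ?_)
  have hsm : StronglyMeasurable (Function.uncurry fun (p : ℝ × ℝ) (X : Fin n → ℝ) =>
      admInd n L a p.1 X * admInd n L a p.2 X) := by
    refine Measurable.stronglyMeasurable (Measurable.mul ?_ ?_)
    · exact (measurable_admInd n L a).comp ((measurable_fst.comp measurable_fst).prodMk measurable_snd)
    · exact (measurable_admInd n L a).comp ((measurable_snd.comp measurable_fst).prodMk measurable_snd)
  exact (hsm.integral_prod_right'
    (ν := volume.restrict (Set.pi Set.univ (fun _ : Fin n => Set.Icc (0 : ℝ) L)))).measurable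

/-- A crude bound on the density matrix: `|ρ_{n+1}(x, y)| ≤ (n+1) Z⁻¹ |[0,L]ⁿ|`. [folklore] -/
theorem abs_neumannRodDensityMatrix_le (x y : ℝ) :
    |neumannRodDensityMatrix (n + 1) L a x y| ≤ (n + 1 : ℝ) * ((tonksIntegral (n + 1) L a)⁻¹ *
      (1 * (volume (Set.pi Set.univ (fun _ : Fin n => Set.Icc (0 : ℝ) L))).toReal)) := by
  have hZ := tonksIntegral_nonneg n L a
  rw [neumannRodDensityMatrix_eq, abs_mul, abs_of_nonneg (by positivity : (0 : ℝ) ≤ n + 1), abs_mul,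
    abs_of_nonneg (inv_nonneg.2 hZ)]
  refine mul_le_mul_of_nonneg_left (mul_le_mul_of_nonneg_left ?_ (inv_nonneg.2 hZ)) (by positivity)
  rw [← Real.norm_eq_abs]
  exact norm_setIntegral_le_of_norm_le_const (volume_box_lt_top n L) fun X _ => by
    rw [norm_mul]
    calc ‖admInd n L a x X‖ * ‖admInd n L a y X‖ ≤ 1 * 1 :=
          mul_le_mul (norm_admInd_le _ _ _ _ _) (norm_admInd_le _ _ _ _ _) (norm_nonneg _) zero_le_one
      _ = 1 := one_mul _

variable {n L a}

/-- **Row bound.** For every tagged position `x`: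
`∫₀ᴸ ρ_{n+1}(x, y) dy ≥ (n+1) Z⁻¹ (L − 2na) ∫ 1_A(X, x) dX` (Fubini in `(y, X)` and the free-length
bound on admissible spectators). [cite: PenroseOnsager1956, §6 (32)–(35)] -/
theorem integral_neumannRodDensityMatrix_row_ge (hL : 0 < L) (ha : 0 ≤ a) (x : ℝ) :
    (n + 1 : ℝ) * ((tonksIntegral (n + 1) L a)⁻¹ * ((L - 2 * n * a) *
      ∫ X in Set.pi Set.univ (fun _ : Fin n => Set.Icc (0 : ℝ) L), admInd n L a x X)) ≤
      ∫ y in Set.Icc 0 L, neumannRodDensityMatrix (n + 1) L a x y := by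
  set box : Set (Fin n → ℝ) := Set.pi Set.univ (fun _ : Fin n => Set.Icc (0 : ℝ) L) with hbox
  have hvolbox : volume box < ⊤ := volume_box_lt_top n L
  have hvolI : volume (Set.Icc (0 : ℝ) L) < ⊤ := by rw [Real.volume_Icc]; exact ENNReal.ofReal_lt_top
  haveI : IsFiniteMeasure (volume.restrict box) := ⟨by rw [Measure.restrict_apply_univ]; exact hvolbox⟩
  haveI : IsFiniteMeasure (volume.restrict (Set.Icc (0 : ℝ) L)) :=
    ⟨by rw [Measure.restrict_apply_univ]; exact hvolI⟩
  have hZ := tonksIntegral_nonneg n L a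
  have hfun : (fun y => neumannRodDensityMatrix (n + 1) L a x y) =
      fun y => (n + 1 : ℝ) * ((tonksIntegral (n + 1) L a)⁻¹ * ∫ X in box, admInd n L a x X * admInd n L a y X) :=
    funext (neumannRodDensityMatrix_eq n L a x)
  rw [hfun, integral_const_mul, integral_const_mul]
  refine mul_le_mul_of_nonneg_left (mul_le_mul_of_nonneg_left ?_ (inv_nonneg.2 hZ)) (by positivity)
  -- Fubini: swap `y` and `X`
  have hInt : Integrable (Function.uncurry fun (y : ℝ) (X : Fin n → ℝ) => admInd n L a x X * admInd n L a y X)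
      ((volume.restrict (Set.Icc (0 : ℝ) L)).prod (volume.restrict box)) := by
    refine Integrable.of_bound ?_ 1 (Eventually.of_forall fun p => ?_)
    · exact (((measurable_admInd n L a).comp (measurable_const.prodMk measurable_snd)).mul
        (measurable_admInd n L a)).aestronglyMeasurable
    · rw [Function.uncurry_def, norm_mul]
      calc ‖admInd n L a x p.2‖ * ‖admInd n L a p.1 p.2‖ ≤ 1 * 1 :=
            mul_le_mul (norm_admInd_le _ _ _ _ _) (norm_admInd_le _ _ _ _ _) (norm_nonneg _) zero_le_one
        _ = 1 := one_mul _
  rw [integral_integral_swap hInt]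
  have hin : ∀ X : Fin n → ℝ, ∫ y in Set.Icc 0 L, admInd n L a x X * admInd n L a y X =
      admInd n L a x X * ∫ y in Set.Icc 0 L, admInd n L a y X := fun X => integral_const_mul _ _
  simp_rw [hin]
  rw [← integral_const_mul]
  -- integrability of both sides on the box
  have hF_le : ∀ X : Fin n → ℝ, ‖∫ y in Set.Icc 0 L, admInd n L a y X‖ ≤ 1 * L := by
    intro X
    have h := norm_setIntegral_le_of_norm_le_const hvolI (f := fun y => admInd n L a y X) (C := 1)
      (fun y _ => norm_admInd_le _ _ _ _ _)
    rwa [Measure.real, Real.volume_Icc, sub_zero, ENNReal.toReal_ofReal hL.le] at h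
  have hint1 : IntegrableOn (fun X => (L - 2 * n * a) * admInd n L a x X) box :=
    IntegrableOn.of_bound hvolbox
      (((measurable_admInd n L a).comp measurable_prodMk_left).const_mul _).aestronglyMeasurable
      (‖L - 2 * n * a‖ * 1) (Eventually.of_forall fun X => by
        rw [norm_mul]; exact mul_le_mul_of_nonneg_left (norm_admInd_le _ _ _ _ _) (norm_nonneg _))
  have hint2 : IntegrableOn (fun X => admInd n L a x X * ∫ y in Set.Icc 0 L, admInd n L a y X) box :=
    IntegrableOn.of_bound hvolbox
      (((measurable_admInd n L a).comp measurable_prodMk_left).mul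
        (measurable_freeLength n L a)).aestronglyMeasurable (1 * (1 * L))
      (Eventually.of_forall fun X => by
        rw [norm_mul]; exact mul_le_mul (norm_admInd_le _ _ _ _ _) (hF_le X) (norm_nonneg _) zero_le_one)
  refine setIntegral_mono_on hint1 hint2 (MeasurableSet.univ_pi fun _ => measurableSet_Icc) fun X hX => ?_
  rcases admInd_eq_zero_or_one n L a x X with h0 | h1
  · rw [h0, mul_zero, zero_mul]
  · rw [h1, mul_one, one_mul]
    have hadm : rodAdmissible L a (Fin.snoc X x) := (admInd_eq_one_iff n L a x X).1 h1
    exact freeLength_ge hL ha (fun j => hX j (Set.mem_univ _)) (rodAdmissible_init hadm)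

/-- **Penrose–Onsager's free-volume estimate as a theorem for Neumann rods.** For `L > 0`,
`a ≥ 0` and `Z_N > 0` (i.e. `L > Na`), the zero-momentum occupation of the Neumann-rod ground state
satisfies `c₀(N) ≥ N (1 − 2(N−1)a/L)`: integrate the row bound over the tagged position and use
`∫₀ᴸ dx ∫ 1_A(X, x) dX = Z_N`. [cite: PenroseOnsager1956, §6 (32)–(35)] [cite: BuffetPule1986, §2.1] -/
theorem neumannRodZeroMomentumOccupation_ge (hL : 0 < L) (ha : 0 ≤ a)
    (hZ : 0 < tonksIntegral (n + 1) L a) :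
    (n + 1 : ℝ) * (1 - 2 * n * a / L) ≤ neumannRodZeroMomentumOccupation (n + 1) L a := by
  set box : Set (Fin n → ℝ) := Set.pi Set.univ (fun _ : Fin n => Set.Icc (0 : ℝ) L) with hbox
  set Z : ℝ := tonksIntegral (n + 1) L a with hZdef
  have hvolbox : volume box < ⊤ := volume_box_lt_top n L
  have hvolI : volume (Set.Icc (0 : ℝ) L) < ⊤ := by rw [Real.volume_Icc]; exact ENNReal.ofReal_lt_top
  -- the two sides as functions of the tagged position are integrable on `[0, L]`
  have hK_le : ∀ x : ℝ, ‖∫ X in box, admInd n L a x X‖ ≤ 1 * (volume box).toReal := fun x =>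
    norm_setIntegral_le_of_norm_le_const hvolbox fun X _ => norm_admInd_le _ _ _ _ _
  have houter1 : IntegrableOn
      (fun x => (n + 1 : ℝ) * (Z⁻¹ * ((L - 2 * n * a) * ∫ X in box, admInd n L a x X))) (Set.Icc 0 L) :=
    IntegrableOn.of_bound hvolI
      ((measurable_const.mul (measurable_const.mul
        ((measurable_admInd_integral n L a).const_mul _))).aestronglyMeasurable)
      (‖(n + 1 : ℝ)‖ * (‖Z⁻¹‖ * (‖L - 2 * n * a‖ * (1 * (volume box).toReal))))
      (Eventually.of_forall fun x => by
        rw [norm_mul, norm_mul, norm_mul]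
        gcongr
        exact hK_le x)
  have hH_meas : Measurable fun x : ℝ => ∫ y in Set.Icc 0 L, neumannRodDensityMatrix (n + 1) L a x y :=
    ((measurable_neumannRodDensityMatrix_uncurry n L a).stronglyMeasurable.integral_prod_right'
      (ν := volume.restrict (Set.Icc (0 : ℝ) L))).measurable
  have houter2 : IntegrableOn (fun x => ∫ y in Set.Icc 0 L, neumannRodDensityMatrix (n + 1) L a x y)
      (Set.Icc 0 L) :=
    IntegrableOn.of_bound hvolI hH_meas.aestronglyMeasurable
      ((n + 1 : ℝ) * (Z⁻¹ * (1 * (volume box).toReal)) * L)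
      (Eventually.of_forall fun x => by
        have h := norm_setIntegral_le_of_norm_le_const hvolI
          (f := fun y => neumannRodDensityMatrix (n + 1) L a x y)
          (C := (n + 1 : ℝ) * (Z⁻¹ * (1 * (volume box).toReal)))
          (fun y _ => by rw [Real.norm_eq_abs]; exact abs_neumannRodDensityMatrix_le n L a x y)
        rwa [Measure.real, Real.volume_Icc, sub_zero, ENNReal.toReal_ofReal hL.le] at h)
  have hmain : ∫ x in Set.Icc 0 L, (n + 1 : ℝ) * (Z⁻¹ * ((L - 2 * n * a) * ∫ X in box, admInd n L a x X)) ≤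
      ∫ x in Set.Icc 0 L, ∫ y in Set.Icc 0 L, neumannRodDensityMatrix (n + 1) L a x y :=
    setIntegral_mono_on houter1 houter2 measurableSet_Icc fun x _ =>
      integral_neumannRodDensityMatrix_row_ge hL ha x
  -- the left-hand side is `(n+1) Z⁻¹ (L − 2na) Z`
  have hZint : ∫ x in Set.Icc 0 L, ∫ X in box, admInd n L a x X = Z := rfl
  rw [integral_const_mul, integral_const_mul, integral_const_mul, hZint,
    show Z⁻¹ * ((L - 2 * n * a) * Z) = L - 2 * n * a by field_simp] at hmain
  unfold neumannRodZeroMomentumOccupation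
  calc (n + 1 : ℝ) * (1 - 2 * n * a / L) = L⁻¹ * ((n + 1 : ℝ) * (L - 2 * n * a)) := by
        field_simp
    _ ≤ L⁻¹ * ∫ x in Set.Icc 0 L, ∫ y in Set.Icc 0 L, neumannRodDensityMatrix (n + 1) L a x y :=
        mul_le_mul_of_nonneg_left hmain (inv_nonneg.2 hL.le)

end Bound

/-! ### Positivity of the configuration integral -/

/-- **A solid neighbourhood of the equally spaced configuration is admissible.** With
`δ = L/(n+1) > a`, `ε = (δ − a)/3` and centres `c_i = (i + ½)δ`, every configuration whose `i`-th
rod is within `ε` of `c_i` is admissible. [folklore] -/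
theorem rodAdmissible_of_near_lattice (hL : 0 < L) (ha : 0 ≤ a) (hNa : (n + 1 : ℝ) * a < L)
    {p : Fin (n + 1) → ℝ}
    (hp : ∀ k : Fin (n + 1), |p k - ((k : ℕ) + 1 / 2 : ℝ) * (L / (n + 1))| < (L / (n + 1) - a) / 3) :
    rodAdmissible L a p := by
  set δ : ℝ := L / (n + 1) with hδ
  set ε : ℝ := (δ - a) / 3 with hε
  have hn1 : (0 : ℝ) < n + 1 := by positivity
  have hL' : L = (n + 1 : ℝ) * δ := by rw [hδ]; field_simp
  have hδa : a < δ := by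
    rw [hδ, lt_div_iff₀ hn1]; nlinarith
  have hδpos : 0 < δ := lt_of_le_of_lt ha hδa
  intro i j hij
  set c : Fin (n + 1) → ℝ := fun k => ((k : ℕ) + 1 / 2 : ℝ) * δ with hc
  have hi : |p i - c i| < ε := hp i
  have hj : |p j - c j| < ε := hp j
  -- centres of distinct indices are between `δ` and `nδ` apart
  have hcc : δ ≤ |c i - c j| ∧ |c i - c j| ≤ n * δ := by
    have hci : c i - c j = (((i : ℕ) : ℝ) - ((j : ℕ) : ℝ)) * δ := by simp only [hc]; ring
    rw [hci, abs_mul, abs_of_pos hδpos]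
    have hij' : (i : ℕ) ≠ (j : ℕ) := fun e => hij (Fin.ext e)
    have hin : ((i : ℕ) : ℝ) ≤ n := by exact_mod_cast Nat.lt_succ_iff.mp i.isLt
    have hjn : ((j : ℕ) : ℝ) ≤ n := by exact_mod_cast Nat.lt_succ_iff.mp j.isLt
    have hi0 : (0 : ℝ) ≤ ((i : ℕ) : ℝ) := Nat.cast_nonneg _
    have hj0 : (0 : ℝ) ≤ ((j : ℕ) : ℝ) := Nat.cast_nonneg _
    rcases lt_or_gt_of_ne hij' with h | h
    · have h1 : ((i : ℕ) : ℝ) + 1 ≤ ((j : ℕ) : ℝ) := by exact_mod_cast h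
      rw [abs_of_neg (by linarith)]
      constructor <;> nlinarith
    · have h1 : ((j : ℕ) : ℝ) + 1 ≤ ((i : ℕ) : ℝ) := by exact_mod_cast h
      rw [abs_of_pos (by linarith)]
      constructor <;> nlinarith
  -- the actual rods: triangle inequalities
  have tri1 : |c i - c j| ≤ |p i - p j| + |p i - c i| + |p j - c j| := by
    rw [show c i - c j = (p i - p j) - ((p i - c i) - (p j - c j)) by ring]
    linarith [abs_sub (p i - p j) ((p i - c i) - (p j - c j)), abs_sub (p i - c i) (p j - c j)]
  have tri2 : |p i - p j| ≤ |c i - c j| + |p i - c i| + |p j - c j| := by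
    rw [show p i - p j = (c i - c j) + ((p i - c i) - (p j - c j)) by ring]
    linarith [abs_add_le (c i - c j) ((p i - c i) - (p j - c j)), abs_sub (p i - c i) (p j - c j)]
  unfold ringDist
  refine le_min ?_ ?_
  · linarith [hcc.1]
  · rw [hL']; nlinarith [hcc.2]

/-- **The configuration integral is positive below close packing**: `Z_{n+1} > 0` whenever
`(n+1)a < L` (a solid neighbourhood of the equally spaced configuration is admissible).
[cite: Tonks1936, hard-rod gas in one dimension] -/
theorem tonksIntegral_pos (hL : 0 < L) (ha : 0 ≤ a) (hNa : (n + 1 : ℝ) * a < L) :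
    0 < tonksIntegral (n + 1) L a := by
  set box : Set (Fin n → ℝ) := Set.pi Set.univ (fun _ : Fin n => Set.Icc (0 : ℝ) L) with hbox
  set δ : ℝ := L / (n + 1) with hδ
  set ε : ℝ := (δ - a) / 3 with hε
  have hn1 : (0 : ℝ) < n + 1 := by positivity
  have hL' : L = (n + 1 : ℝ) * δ := by rw [hδ]; field_simp
  have hδa : a < δ := by rw [hδ, lt_div_iff₀ hn1]; nlinarith
  have hδpos : 0 < δ := lt_of_le_of_lt ha hδa
  have hεpos : 0 < ε := by rw [hε]; linarith
  have hεδ : 3 * ε ≤ δ := by rw [hε]; linarith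
  have hvolbox : volume box < ⊤ := volume_box_lt_top n L
  have hvolI : volume (Set.Icc (0 : ℝ) L) < ⊤ := by rw [Real.volume_Icc]; exact ENNReal.ofReal_lt_top
  haveI : IsFiniteMeasure (volume.restrict box) := ⟨by rw [Measure.restrict_apply_univ]; exact hvolbox⟩
  haveI : IsFiniteMeasure (volume.restrict (Set.Icc (0 : ℝ) L)) :=
    ⟨by rw [Measure.restrict_apply_univ]; exact hvolI⟩
  -- centres and the solid neighbourhood `U × W`
  set c : Fin (n + 1) → ℝ := fun k => ((k : ℕ) + 1 / 2 : ℝ) * δ with hc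
  set U : Set ℝ := Set.Ioo (c (Fin.last n) - ε) (c (Fin.last n) + ε) with hU
  set lo : Fin n → ℝ := fun j => c (Fin.castSucc j) - ε with hlo
  set hi : Fin n → ℝ := fun j => c (Fin.castSucc j) + ε with hhi
  set W : Set (Fin n → ℝ) := Set.pi Set.univ fun j => Set.Ioo (lo j) (hi j) with hW
  have hUmeas : MeasurableSet U := measurableSet_Ioo
  have hWmeas : MeasurableSet W := MeasurableSet.univ_pi fun _ => measurableSet_Ioo
  have hclast : c (Fin.last n) = (n + 1 / 2 : ℝ) * δ := by simp [hc]
  have hccast : ∀ j : Fin n, c (Fin.castSucc j) = (((j : ℕ) : ℝ) + 1 / 2) * δ := fun j => by simp [hc]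
  have hUIcc : U ⊆ Set.Icc 0 L := by
    intro x hx
    rw [hU, Set.mem_Ioo, hclast] at hx
    constructor
    · nlinarith [hx.1]
    · rw [hL']; nlinarith [hx.2]
  have hWbox : W ⊆ box := by
    intro X hX j _
    have h := hX j (Set.mem_univ _)
    rw [Set.mem_Ioo] at h
    simp only [hlo, hhi, hccast] at h
    have hjn : ((j : ℕ) : ℝ) + 1 ≤ n := by exact_mod_cast j.isLt
    have hj0 : (0 : ℝ) ≤ ((j : ℕ) : ℝ) := Nat.cast_nonneg _
    constructor
    · nlinarith [h.1]
    · rw [hL']; nlinarith [h.2]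
  -- admissibility on `U × W`
  have hA : ∀ x ∈ U, ∀ X ∈ W, rodAdmissible L a (Fin.snoc X x) := by
    intro x hx X hX
    refine rodAdmissible_of_near_lattice hL ha hNa fun k => ?_
    induction k using Fin.lastCases with
    | last =>
      rw [Fin.snoc_last]
      rw [hU, Set.mem_Ioo] at hx
      simp only [Fin.val_last]
      rw [hclast] at hx
      exact abs_sub_lt_iff.2 ⟨by linarith [hx.2], by linarith [hx.1]⟩
    | cast k =>
      rw [Fin.snoc_castSucc]
      have h := hX k (Set.mem_univ _)
      rw [Set.mem_Ioo] at h
      simp only [hlo, hhi, hccast] at h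
      simp only [Fin.val_castSucc]
      exact abs_sub_lt_iff.2 ⟨by linarith [h.2], by linarith [h.1]⟩
  -- the minorant `g(x, X) = 1_U(x) 1_W(X) ≤ 1_A(X, x)`
  set g : ℝ → (Fin n → ℝ) → ℝ := fun x X => U.indicator 1 x * W.indicator 1 X with hg
  have hg_le : ∀ x X, g x X ≤ admInd n L a x X := by
    intro x X
    simp only [hg]
    by_cases hx : x ∈ U
    · by_cases hX : X ∈ W
      · rw [Set.indicator_of_mem hx, Set.indicator_of_mem hX, Pi.one_apply, Pi.one_apply, one_mul]
        exact ((admInd_eq_one_iff n L a x X).2 (hA x hx X hX)).ge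
      · rw [Set.indicator_of_notMem hX, mul_zero]; exact admInd_nonneg _ _ _ _ _
    · rw [Set.indicator_of_notMem hx, zero_mul]; exact admInd_nonneg _ _ _ _ _
  have hg_meas : ∀ x, Measurable (g x) := fun x =>
    ((measurable_const.indicator hWmeas).const_mul _)
  have hg_bd : ∀ x X, ‖g x X‖ ≤ 1 := by
    intro x X
    simp only [hg]
    rw [norm_mul]
    refine mul_le_one₀ ?_ (norm_nonneg _) ?_
    · by_cases hh : x ∈ U <;> simp [hh]
    · by_cases hh : X ∈ W <;> simp [hh]
  -- inner integrals of the minorant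
  have hinner : ∀ x, ∫ X in box, g x X = U.indicator 1 x * (volume W).toReal := by
    intro x
    simp only [hg]
    rw [integral_const_mul, setIntegral_indicator hWmeas, Set.inter_eq_right.2 hWbox]
    simp only [Pi.one_apply]
    rw [setIntegral_const, smul_eq_mul, mul_one]
    rfl
  have hWvol : (volume W).toReal = ∏ _j : Fin n, (2 * ε) := by
    rw [hW, Real.volume_pi_Ioo_toReal (fun j => by simp only [hlo, hhi]; linarith)]
    refine Finset.prod_congr rfl fun j _ => ?_
    simp only [hlo, hhi]; ring
  have hWpos : 0 < (volume W).toReal := by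
    rw [hWvol]; exact Finset.prod_pos fun j _ => by linarith
  -- compare with `Z`
  have hZ_ge : ∫ x in Set.Icc 0 L, ∫ X in box, g x X ≤ tonksIntegral (n + 1) L a := by
    show _ ≤ ∫ x in Set.Icc 0 L, ∫ X in box, admInd n L a x X
    refine setIntegral_mono_on ?_ ?_ measurableSet_Icc fun x _ => ?_
    · have hfun : (fun x => ∫ X in box, g x X) = fun x => U.indicator 1 x * (volume W).toReal :=
        funext hinner
      rw [hfun]
      exact IntegrableOn.of_bound hvolI
        (((measurable_const.indicator hUmeas).mul_const _).aestronglyMeasurable)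
        (1 * (volume W).toReal) (Eventually.of_forall fun x => by
          rw [norm_mul, Real.norm_of_nonneg hWpos.le]
          refine mul_le_mul_of_nonneg_right ?_ hWpos.le
          by_cases hh : x ∈ U <;> simp [hh])
    · exact IntegrableOn.of_bound hvolI (measurable_admInd_integral n L a).aestronglyMeasurable
        (1 * (volume box).toReal) (Eventually.of_forall fun x =>
          norm_setIntegral_le_of_norm_le_const hvolbox fun X _ => norm_admInd_le _ _ _ _ _)
    · refine setIntegral_mono_on ?_ ?_ (MeasurableSet.univ_pi fun _ => measurableSet_Icc)
        fun X _ => hg_le x X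
      · exact IntegrableOn.of_bound hvolbox (hg_meas x).aestronglyMeasurable 1
          (Eventually.of_forall fun X => hg_bd x X)
      · exact IntegrableOn.of_bound hvolbox
          ((measurable_admInd n L a).comp measurable_prodMk_left).aestronglyMeasurable 1
          (Eventually.of_forall fun X => norm_admInd_le _ _ _ _ _)
  have hval : ∫ x in Set.Icc 0 L, ∫ X in box, g x X = (volume U).toReal * (volume W).toReal := by
    simp_rw [hinner]
    rw [integral_mul_const, setIntegral_indicator hUmeas, Set.inter_eq_right.2 hUIcc]
    simp only [Pi.one_apply]
    rw [setIntegral_const, smul_eq_mul, mul_one]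
    rfl
  have hUvol : (volume U).toReal = 2 * ε := by
    rw [hU, Real.volume_Ioo, ENNReal.toReal_ofReal (by linarith)]; ring
  calc (0 : ℝ) < (volume U).toReal * (volume W).toReal := mul_pos (by rw [hUvol]; linarith) hWpos
    _ = ∫ x in Set.Icc 0 L, ∫ X in box, g x X := hval.symm
    _ ≤ tonksIntegral (n + 1) L a := hZ_ge

/-! ### Condensation: consequences along the thermodynamic limit `L = N/ρ` -/

/-- **Neumann rods condense.** For rods of length `a ≥ 0` at density `ρ > 0` with `ρa < 1/2`, the
condensate fraction of the Neumann-rod ground state on the ring of circumference `N/ρ` is at least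
`1 − 2ρa > 0` for EVERY `N ≥ 1`: `c₀(N) ≥ (1 − 2ρa) N`. (The exact thermodynamic limit is
`c₀(N)/N → (1 − ρa)e^{−ρa/(1−ρa)}`, the Tonks-gas insertion probability, for every `ρa < 1`.)
[cite: PenroseOnsager1956, §6 (32)–(35)] [cite: Widom1963, insertion probability] -/
theorem neumannRod_condensateFraction_ge (ha : 0 ≤ a) {ρ : ℝ} (hρ : 0 < ρ) (h : ρ * a < 1 / 2)
    {N : ℕ} (hN : 1 ≤ N) :
    (1 - 2 * ρ * a) * N ≤ neumannRodZeroMomentumOccupation N (N / ρ) a := by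
  obtain ⟨n, rfl⟩ : ∃ n, N = n + 1 := ⟨N - 1, by omega⟩
  have hn1 : (0 : ℝ) < (n + 1 : ℕ) := by positivity
  have hL : (0 : ℝ) < (n + 1 : ℕ) / ρ := by positivity
  have hNa : (n + 1 : ℝ) * a < (n + 1 : ℕ) / ρ := by
    rw [lt_div_iff₀ hρ]; push_cast; nlinarith
  have hZ := tonksIntegral_pos hL ha hNa
  have hb := neumannRodZeroMomentumOccupation_ge hL ha hZ
  refine le_trans ?_ hb
  -- `(1 − 2ρa)(n+1) ≤ (n+1)(1 − 2na/L)` with `L = (n+1)/ρ`, since `2na/L = 2ρa·n/(n+1) ≤ 2ρa`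
  have hkey : 2 * n * a / ((n + 1 : ℕ) / ρ) ≤ 2 * ρ * a := by
    rw [div_le_iff₀ hL]
    rw [show 2 * ρ * a * ((n + 1 : ℕ) / ρ) = 2 * a * (n + 1 : ℕ) by field_simp]
    push_cast
    nlinarith
  calc (1 - 2 * ρ * a) * ((n + 1 : ℕ) : ℝ) = (n + 1 : ℝ) * (1 - 2 * ρ * a) := by push_cast; ring
    _ ≤ (n + 1 : ℝ) * (1 - 2 * n * a / ((n + 1 : ℕ) / ρ)) :=
        mul_le_mul_of_nonneg_left (by linarith [hkey]) (by positivity)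

/-- **The conjunct's `HasGroundStateBEC` shape HOLDS for Neumann rods** (constant mode): for rods
of length `a ≥ 0` at any density `ρ < 1/(2a)` there is `c > 0` with `c N ≤ c₀(N)` for all large
(indeed all positive) `N`, along `L = N/ρ`. [cite: PenroseOnsager1956, §6 (32)–(35)] -/
theorem exists_linear_le_neumannRodZeroMomentumOccupation (ha : 0 ≤ a) {ρ : ℝ} (hρ : 0 < ρ)
    (h : ρ * a < 1 / 2) :
    ∃ c : ℝ, 0 < c ∧ ∀ᶠ N : ℕ in atTop, c * N ≤ neumannRodZeroMomentumOccupation N (N / ρ) a :=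
  ⟨1 - 2 * ρ * a, by linarith, eventually_atTop.2 ⟨1, fun _ hN => neumannRod_condensateFraction_ge ha hρ h hN⟩⟩

/-- **Sterics do not decide; the contact law does.** For every rod length `a ≥ 0` and every
density `ρ` with `ρa < 1/2`, on the SAME configuration domain (all cyclic pair distances `≥ a`) along
`L = N/ρ`: the Neumann-contact ground state `Z_N^{-1/2} 1_{A_N}` has condensate fraction
`≥ 1 − 2ρa > 0` for every `N ≥ 1`, while the Dirichlet-contact (true hard-core) ground state — the
Nagamiya–Girardeau rod state of `OneDimensionalHardRods` — has `c₀(N)/N → 0`. Both states are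
non-negative, permutation symmetric and translation invariant, with the same support.
[cite: PenroseOnsager1956, §6 (32)–(35)] [cite: MazzantiEtAl2008, Eqs. (2)–(3)] -/
theorem neumann_vs_dirichlet_rods (ha : 0 ≤ a) {ρ : ℝ} (hρ : 0 < ρ) (h : ρ * a < 1 / 2) :
    (∀ N : ℕ, 1 ≤ N → (1 - 2 * ρ * a) * N ≤ neumannRodZeroMomentumOccupation N (N / ρ) a) ∧
      Tendsto (fun N : ℕ => rodZeroMomentumOccupation N (N / ρ) a / N) atTop (𝓝 0) :=
  ⟨fun _ hN => neumannRod_condensateFraction_ge ha hρ h hN, OneDimensionalHardRods_holds a ha ρ hρ h⟩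

end Literature.Barriers.AtomisticToContinuum.BoseGas

end
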